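import Literature.NumberTheory.Transcendental.CalegariDimitrovTangL2Chi3
import Mathlib.Topology.Algebra.InfiniteSum.NatInt
import Mathlib.Tactic
import HarnessLib

/-!
# Calegari–Dimitrov–Tang, Corollary 2, lines 3–4: the residues `±1 (mod 6)`

Sibling of `CalegariDimitrovTangL2Chi3.lean` (named fact
`Literature.NumberTheory.Transcendental.calegariDimitrovTang_linearIndependent`, CDT 2024
Thm. 1), which proves the mod-`3` decomposition of `ζ(2)` and lines 1–2 of Corollary 2 and
records that "the mod-`6` lines of Corollary 2 … are not formalised". CDT, Cor. 2 (p. 3):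
"The following numbers are irrational: …
`1/1² + 1/7² + 1/13² + 1/19² + … = 5L(2,χ₋₃)/8 + π²/18`,
`1/5² + 1/11² + 1/17² + 1/23² + … = −5L(2,χ₋₃)/8 + π²/18`"
(values of the trigamma function `ψ₁(z) = ζ(2,z)` at `z = 1/6, 5/6`, divided by `36`).

This file proves the two **values** unconditionally and the two **irrationality** statements
from the fact taken as a hypothesis:

* `tsum_one_div_six_mul_add_one_sq` — `Σ_{k≥0} 1/(6k+1)² = 5L(2,χ₋₃)/8 + π²/18`;
* `tsum_one_div_six_mul_add_five_sq` — `Σ_{k≥0} 1/(6k+5)² = −5L(2,χ₋₃)/8 + π²/18`;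
* `calegariDimitrovTang_linearIndependent.irrational_tsum_one_div_six_mul_add_one_sq`,
  `….irrational_tsum_one_div_six_mul_add_five_sq` — Cor. 2, lines 3 and 4.

Method: split the mod-`3` series of the sibling file along even/odd `k`
(`HasSum.even_add_odd`): `Σ_k 1/(3k+1)² = Σ_j 1/(6j+1)² + Σ_j 1/(6j+4)²` with
`1/(6j+4)² = ¼ · 1/(3j+2)²`, and `Σ_k 1/(3k+2)² = Σ_j 1/(6j+2)² + Σ_j 1/(6j+5)²` with
`1/(6j+2)² = ¼ · 1/(3j+1)²`; then insert `tsum_one_div_three_mul_add_one_sq`,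
`tsum_one_div_three_mul_add_two_sq`. No named facts (D-0026).

## References

* [CalegariDimitrovTang2024] arXiv:2408.15403, Cor. 2 (p. 3).
-/

noncomputable section

open Filter Real

namespace Literature.NumberTheory.Transcendental

/-! ### The series along residues mod `6` -/

/-- `∑_{k ≥ 0} 1/(6k + r)²` converges (a subseries of `∑ 1/n²`). [folklore] -/
theorem summable_one_div_six_mul_add_sq (r : ℕ) :
    Summable fun k : ℕ => 1 / (6 * (k : ℝ) + r) ^ 2 := by
  have h := hasSum_zeta_two.summable.comp_injective
    (i := fun k : ℕ => k * 6 + r) (fun a b hab => by simpa using hab)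
  refine h.congr fun k => ?_
  simp only [Function.comp_apply]
  push_cast
  ring_nf

/-- **The even/odd split of `Σ 1/(3k+1)²`**:
`Σ_k 1/(3k+1)² = Σ_j 1/(6j+1)² + ¼ Σ_j 1/(3j+2)²` (`k = 2j` gives `6j+1`, `k = 2j+1` gives
`6j+4 = 2(3j+2)`). [folklore] -/
theorem tsum_one_div_three_mul_add_one_sq_eq_add :
    ∑' k : ℕ, 1 / (3 * (k : ℝ) + 1) ^ 2 =
      (∑' j : ℕ, 1 / (6 * (j : ℝ) + 1) ^ 2) + (1 / 4) * ∑' j : ℕ, 1 / (3 * (j : ℝ) + 2) ^ 2 := by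
  have he : HasSum (fun j : ℕ => 1 / (3 * ((2 * j : ℕ) : ℝ) + 1) ^ 2)
      (∑' j : ℕ, 1 / (6 * (j : ℝ) + 1) ^ 2) := by
    have hs : Summable (fun j : ℕ => 1 / (6 * (j : ℝ) + 1) ^ 2) := by
      simpa using summable_one_div_six_mul_add_sq 1
    have e : (fun j : ℕ => 1 / (3 * ((2 * j : ℕ) : ℝ) + 1) ^ 2)
        = fun j : ℕ => 1 / (6 * (j : ℝ) + 1) ^ 2 := by
      funext j
      push_cast
      ring
    rw [e]
    exact hs.hasSum
  have ho : HasSum (fun j : ℕ => 1 / (3 * ((2 * j + 1 : ℕ) : ℝ) + 1) ^ 2)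
      ((1 / 4) * ∑' j : ℕ, 1 / (3 * (j : ℝ) + 2) ^ 2) := by
    have h := (summable_one_div_three_mul_add_two_sq.hasSum).mul_left (1 / 4)
    have e : (fun j : ℕ => 1 / (3 * ((2 * j + 1 : ℕ) : ℝ) + 1) ^ 2)
        = fun j : ℕ => 1 / 4 * (1 / (3 * (j : ℝ) + 2) ^ 2) := by
      funext j
      have h4 : (3 * ((2 * j + 1 : ℕ) : ℝ) + 1) ^ 2 = 4 * (3 * (j : ℝ) + 2) ^ 2 := by
        push_cast
        ring
      rw [h4, ← one_div_mul_one_div]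
    rw [e]
    exact h
  exact (HasSum.even_add_odd (f := fun k : ℕ => 1 / (3 * (k : ℝ) + 1) ^ 2) he ho).tsum_eq

/-- **The even/odd split of `Σ 1/(3k+2)²`**:
`Σ_k 1/(3k+2)² = ¼ Σ_j 1/(3j+1)² + Σ_j 1/(6j+5)²` (`k = 2j` gives `6j+2 = 2(3j+1)`,
`k = 2j+1` gives `6j+5`). [folklore] -/
theorem tsum_one_div_three_mul_add_two_sq_eq_add :
    ∑' k : ℕ, 1 / (3 * (k : ℝ) + 2) ^ 2 =
      (1 / 4) * (∑' j : ℕ, 1 / (3 * (j : ℝ) + 1) ^ 2) + ∑' j : ℕ, 1 / (6 * (j : ℝ) + 5) ^ 2 := by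
  have he : HasSum (fun j : ℕ => 1 / (3 * ((2 * j : ℕ) : ℝ) + 2) ^ 2)
      ((1 / 4) * ∑' j : ℕ, 1 / (3 * (j : ℝ) + 1) ^ 2) := by
    have h := (summable_one_div_three_mul_add_one_sq.hasSum).mul_left (1 / 4)
    have e : (fun j : ℕ => 1 / (3 * ((2 * j : ℕ) : ℝ) + 2) ^ 2)
        = fun j : ℕ => 1 / 4 * (1 / (3 * (j : ℝ) + 1) ^ 2) := by
      funext j
      have h4 : (3 * ((2 * j : ℕ) : ℝ) + 2) ^ 2 = 4 * (3 * (j : ℝ) + 1) ^ 2 := by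
        push_cast
        ring
      rw [h4, ← one_div_mul_one_div]
    rw [e]
    exact h
  have ho : HasSum (fun j : ℕ => 1 / (3 * ((2 * j + 1 : ℕ) : ℝ) + 2) ^ 2)
      (∑' j : ℕ, 1 / (6 * (j : ℝ) + 5) ^ 2) := by
    have hs : Summable (fun j : ℕ => 1 / (6 * (j : ℝ) + 5) ^ 2) := by
      simpa using summable_one_div_six_mul_add_sq 5
    have e : (fun j : ℕ => 1 / (3 * ((2 * j + 1 : ℕ) : ℝ) + 2) ^ 2)
        = fun j : ℕ => 1 / (6 * (j : ℝ) + 5) ^ 2 := by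
      funext j
      push_cast
      ring
    rw [e]
    exact hs.hasSum
  exact (HasSum.even_add_odd (f := fun k : ℕ => 1 / (3 * (k : ℝ) + 2) ^ 2) he ho).tsum_eq

/-- **Corollary 2, line 3 (the value)**: `1/1² + 1/7² + 1/13² + 1/19² + ⋯ = 5L(2,χ₋₃)/8 + π²/18`.
[cite: CalegariDimitrovTang2024, Cor. 2 (p. 3)] -/
theorem tsum_one_div_six_mul_add_one_sq :
    ∑' k : ℕ, 1 / (6 * (k : ℝ) + 1) ^ 2 = 5 * L2chi3 / 8 + Real.pi ^ 2 / 18 := by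
  have h1 := tsum_one_div_three_mul_add_one_sq_eq_add
  rw [tsum_one_div_three_mul_add_one_sq, tsum_one_div_three_mul_add_two_sq] at h1
  linarith

/-- **Corollary 2, line 4 (the value)**: `1/5² + 1/11² + 1/17² + 1/23² + ⋯ = −5L(2,χ₋₃)/8 + π²/18`.
[cite: CalegariDimitrovTang2024, Cor. 2 (p. 3)] -/
theorem tsum_one_div_six_mul_add_five_sq :
    ∑' k : ℕ, 1 / (6 * (k : ℝ) + 5) ^ 2 = -(5 * L2chi3 / 8) + Real.pi ^ 2 / 18 := by
  have h2 := tsum_one_div_three_mul_add_two_sq_eq_add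
  rw [tsum_one_div_three_mul_add_one_sq, tsum_one_div_three_mul_add_two_sq] at h2
  linarith

/-! ### Corollary 2, lines 3–4: irrationality (from Theorem 1) -/

/-- **Corollary 2, line 3**: `1/1² + 1/7² + 1/13² + ⋯ = ψ₁(1/6)/36` is irrational (from
Theorem 1: it is `5L(2,χ₋₃)/8 + π²/18`, with non-zero coefficient of `L(2,χ₋₃)`).
[cite: CalegariDimitrovTang2024, Cor. 2 (p. 3)] -/
theorem calegariDimitrovTang_linearIndependent.irrational_tsum_one_div_six_mul_add_one_sq
    (h : calegariDimitrovTang_linearIndependent) :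
    Irrational (∑' k : ℕ, 1 / (6 * (k : ℝ) + 1) ^ 2) := by
  rw [tsum_one_div_six_mul_add_one_sq]
  rintro ⟨q, hq⟩
  have := (h.eq_zero q (-(1 / 18)) (-(5 / 8)) (by push_cast; linarith)).2.2
  norm_num at this

/-- **Corollary 2, line 4**: `1/5² + 1/11² + 1/17² + ⋯ = ψ₁(5/6)/36` is irrational.
[cite: CalegariDimitrovTang2024, Cor. 2 (p. 3)] -/
theorem calegariDimitrovTang_linearIndependent.irrational_tsum_one_div_six_mul_add_five_sq
    (h : calegariDimitrovTang_linearIndependent) :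
    Irrational (∑' k : ℕ, 1 / (6 * (k : ℝ) + 5) ^ 2) := by
  rw [tsum_one_div_six_mul_add_five_sq]
  rintro ⟨q, hq⟩
  have := (h.eq_zero q (-(1 / 18)) (5 / 8) (by push_cast; linarith)).2.2
  norm_num at this

end Literature.NumberTheory.Transcendental
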